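import Mathlib.Algebra.Lie.UniversalEnveloping
import Mathlib.Algebra.Field.ZMod
import Mathlib.Algebra.Module.ZMod
import Mathlib.LinearAlgebra.Basis.VectorSpace
import Mathlib.LinearAlgebra.FreeModule.Basic
import Mathlib.SetTheory.Cardinal.Order
import Mathlib.RingTheory.Nakayama
import Mathlib.RingTheory.Noetherian.Basic
import Mathlib.RingTheory.PrincipalIdealDomain
import Mathlib.RingTheory.Int.Basic
import Mathlib.GroupTheory.OrderOfElement
import Literature.Algebra.Lie.FreeLieAlgebraGrading
import Literature.Algebra.Lie.PoincareBirkhoffWitt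
import HarnessLib

/-!
# Witt's embedding theorem: the free Lie ring embeds in the free associative ring

Topic `Literature/Algebra/Lie`. For a set `X`, the canonical morphism
`φ : L(X) → T(X) = R[FreeMonoid X]` from the free Lie algebra to the free associative algebra
(letters to letters; `Literature.Algebra.Lie.toTensor`) is **injective**:

* over a field `K` (`toTensor_injective_of_field`): by the Poincaré–Birkhoff–Witt theorem of the
  tree (`Literature/Algebra/Lie/PoincareBirkhoffWitt.lean`, `PBW.ι_injective`, valid for any Lie
  algebra with a basis) `L(X) → U(L(X))` is injective, and `U(L(X)) ≅ T(X)` (Mathlib's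
  `FreeLieAlgebra.universalEnvelopingEquivFreeAlgebra`);
* over `ℤ`, for a finite alphabet (`toTensor_int_injective`, **Witt 1937**, Satz 3 / Magnus 1937;
  Bourbaki LIE II §3 no. 1 Thm. 1; Reutenauer, *Free Lie algebras*, Thm. 0.5 & Cor. 1.4): the
  classical proofs use Hall or Lyndon bases, which Mathlib lacks. We argue instead: in a fixed
  degree `n` the kernel `K_n` is a finitely generated abelian group (`fg_freeLieGrade`); reducing
  modulo a prime `p` and using injectivity over `𝔽_p` together with `ker(L_ℤ(X) → L_{𝔽_p}(X)) =
  p L_ℤ(X)` (`exists_eq_smul_of_redLie_eq_zero`) and the torsion-freeness of `T_ℤ(X)` gives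
  `K_n = p K_n` for every prime `p`, whence `K_n = 0` (`eq_bot_of_forall_prime`).

Consequences: the free Lie ring on a finite set is torsion-free, indeed each homogeneous piece is
a finitely generated free abelian group (`noZeroSMulDivisors_int_freeLieAlgebra`).

Everything is proved; there are no named facts.

## References

* E. Witt, Treue Darstellung Liescher Ringe, J. reine angew. Math. 177 (1937) 152–160, Satz 3.
* W. Magnus, Über Beziehungen zwischen höheren Kommutatoren, J. reine angew. Math. 177 (1937).
* N. Bourbaki, *Lie groups and Lie algebras*, Ch. II §3 no. 1, Theorem 1.
* C. Reutenauer, *Free Lie Algebras*, Oxford 1993, Theorem 0.5, Corollary 1.4.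
* J. E. Humphreys, *Introduction to Lie algebras and representation theory*, §17.3 Cor. B (PBW).
  [Humphreys1972]
-/

noncomputable section

namespace Literature.Algebra.Lie

-- Mathlib idiom: the commutator bracket on an associative algebra.
attribute [local instance 100] LieRing.ofAssociativeRing

/-! ## An induction and an extensionality principle for `FreeLieAlgebra ℤ X` -/

section Ext

variable {X : Type*}

/-- **Induction on the free Lie ring**: a predicate holding on letters and `0` and stable under
`+`, negation and brackets holds everywhere (elements are `ℤ`-combinations of iterated brackets of
letters). [folklore] -/
theorem freeLieAlgebra_int_induction {P : FreeLieAlgebra ℤ X → Prop} (u : FreeLieAlgebra ℤ X)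
    (hof : ∀ x, P (FreeLieAlgebra.of ℤ x)) (hzero : P 0) (hadd : ∀ a b, P a → P b → P (a + b))
    (hneg : ∀ a, P a → P (-a)) (hlie : ∀ a b, P a → P b → P ⁅a, b⁆) : P u := by
  induction u using Quot.ind with
  | mk a =>
  change P (FreeLieAlgebra.mk ℤ a)
  induction a using MonoidAlgebra.induction_linear with
  | zero => rw [map_zero]; exact hzero
  | add a b ha hb => rw [map_add]; exact hadd _ _ ha hb
  | single m c =>
    -- `single m c = c • single m 1`, and the word `m` is an iterated bracket of letters
    have hm : P (FreeLieAlgebra.mk ℤ (MonoidAlgebra.single m 1)) := by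
      induction m using FreeMagma.recOnMul with
      | ih1 x => exact hof x
      | ih2 m₁ m₂ h₁ h₂ =>
        have : (MonoidAlgebra.single (m₁ * m₂) 1 : FreeNonUnitalNonAssocAlgebra ℤ X) =
            MonoidAlgebra.single m₁ 1 * MonoidAlgebra.single m₂ 1 := by
          rw [MonoidAlgebra.single_mul_single, mul_one]
        rw [this, map_mul]
        exact hlie _ _ h₁ h₂
    have hc : (MonoidAlgebra.single m c : FreeNonUnitalNonAssocAlgebra ℤ X) = c • MonoidAlgebra.single m 1 := by
      rw [MonoidAlgebra.smul_single', mul_one]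
    rw [hc, map_smul]
    clear hc
    -- closure under integer multiples from `0`, `+`, `-`
    induction c using Int.induction_on with
    | zero => rw [zero_smul]; exact hzero
    | succ n ih => rw [add_smul, one_smul]; exact hadd _ _ ih hm
    | pred n ih => rw [sub_smul, one_smul, sub_eq_add_neg]; exact hadd _ _ ih (hneg _ hm)

variable {B : Type*} [LieRing B]

/-- Two additive maps `FreeLieAlgebra ℤ X → B` into a Lie ring which respect brackets and agree on
the letters are equal. (Stated for additive maps to sidestep any choice of `ℤ`-algebra
structures.) [folklore] -/
theorem addMonoidHom_ext_of_map_lie {f g : FreeLieAlgebra ℤ X →+ B}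
    (hf : ∀ a b, f ⁅a, b⁆ = ⁅f a, f b⁆) (hg : ∀ a b, g ⁅a, b⁆ = ⁅g a, g b⁆)
    (h : ∀ x, f (FreeLieAlgebra.of ℤ x) = g (FreeLieAlgebra.of ℤ x)) : f = g := by
  refine AddMonoidHom.ext fun u => freeLieAlgebra_int_induction (P := fun u => f u = g u) u h ?_ ?_ ?_ ?_
  · rw [map_zero, map_zero]
  · intro a b ha hb; rw [map_add, map_add, ha, hb]
  · intro a ha; rw [map_neg, map_neg, ha]
  · intro a b ha hb; rw [hf, hg, ha, hb]

end Ext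

/-! ## Over a field: injectivity from the Poincaré–Birkhoff–Witt theorem -/

section Field

variable (K : Type*) [Field K] (X : Type*)

/-- The composite `L(X) →ι U(L(X)) ≅ FreeAlgebra K X ≅ K[FreeMonoid X]` is `toTensor`. [folklore] -/
theorem toTensor_eq_comp_ι :
    (toTensor K X : FreeLieAlgebra K X → MonoidAlgebra K (FreeMonoid X)) =
      (FreeAlgebra.equivMonoidAlgebraFreeMonoid (R := K) (X := X)) ∘
        (FreeLieAlgebra.universalEnvelopingEquivFreeAlgebra K X) ∘
          UniversalEnvelopingAlgebra.ι K := by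
  let e : UniversalEnvelopingAlgebra K (FreeLieAlgebra K X) →ₐ[K] MonoidAlgebra K (FreeMonoid X) :=
    (FreeAlgebra.equivMonoidAlgebraFreeMonoid (R := K) (X := X)).toAlgHom.comp
      (FreeLieAlgebra.universalEnvelopingEquivFreeAlgebra K X).toAlgHom
  have key : toTensor K X = (e.toLieHom).comp (UniversalEnvelopingAlgebra.ι K) := by
    refine FreeLieAlgebra.hom_ext fun x => ?_
    rw [toTensor_of, LieHom.comp_apply, AlgHom.toLieHom_apply]
    change _ = FreeAlgebra.equivMonoidAlgebraFreeMonoid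
      (FreeLieAlgebra.universalEnvelopingEquivFreeAlgebra K X (UniversalEnvelopingAlgebra.ι K _))
    rw [FreeLieAlgebra.universalEnvelopingEquivFreeAlgebra_apply, UniversalEnvelopingAlgebra.lift_ι_apply,
      FreeLieAlgebra.lift_of_apply]
    unfold FreeAlgebra.equivMonoidAlgebraFreeMonoid
    rw [AlgEquiv.ofAlgHom_apply, FreeAlgebra.lift_ι_apply]
    rfl
  rw [key]
  rfl

/-- **Over a field the free Lie algebra embeds in the free associative algebra** (PBW).
[cite: Humphreys1972, §17.3 Corollary B (applied to L(X), with U(L(X)) = T(X))] -/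
theorem toTensor_injective_of_field : Function.Injective (toTensor K X) := by
  classical
  let b := Module.Free.chooseBasis K (FreeLieAlgebra K X)
  letI : LinearOrder (Module.Free.ChooseBasisIndex K (FreeLieAlgebra K X)) :=
    linearOrderOfSTO WellOrderingRel
  have hι : Function.Injective (UniversalEnvelopingAlgebra.ι K : FreeLieAlgebra K X → _) :=
    PBW.ι_injective b
  rw [toTensor_eq_comp_ι]
  exact (AlgEquiv.injective _).comp ((AlgEquiv.injective _).comp hι)

end Field

/-! ## Reduction modulo `p` -/

section Reduction

variable (X : Type*) (p : ℕ)

/-- Reduction of scalars `L_ℤ(X) → L_{𝔽_p}(X)` (letters to letters). [folklore] -/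
def redLie : FreeLieAlgebra ℤ X →ₗ⁅ℤ⁆ FreeLieAlgebra (ZMod p) X :=
  FreeLieAlgebra.lift ℤ (FreeLieAlgebra.of (ZMod p))

/-- `redLie` on letters. [folklore] -/
@[simp] theorem redLie_of (x : X) : redLie X p (FreeLieAlgebra.of ℤ x) = FreeLieAlgebra.of (ZMod p) x :=
  FreeLieAlgebra.lift_of_apply _ x

/-- Reduction of coefficients `ℤ[FreeMonoid X] → 𝔽_p[FreeMonoid X]`. [folklore] -/
def redTensor : MonoidAlgebra ℤ (FreeMonoid X) →+* MonoidAlgebra (ZMod p) (FreeMonoid X) :=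
  MonoidAlgebra.mapRingHom _ (Int.castRingHom (ZMod p))

/-- `redTensor` on words. [folklore] -/
@[simp] theorem redTensor_single (w : FreeMonoid X) (c : ℤ) :
    redTensor X p (MonoidAlgebra.single w c) = MonoidAlgebra.single w (c : ZMod p) := by
  rw [redTensor, MonoidAlgebra.mapRingHom_single]; rfl

/-- The reductions intertwine the embeddings: `redTensor ∘ φ_ℤ = φ_p ∘ redLie`. [folklore] -/
theorem redTensor_toTensor (u : FreeLieAlgebra ℤ X) :
    redTensor X p (toTensor ℤ X u) = toTensor (ZMod p) X (redLie X p u) := by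
  have key : ((redTensor X p : MonoidAlgebra ℤ (FreeMonoid X) →+ _).comp
      (toTensor ℤ X).toLinearMap.toAddMonoidHom) =
      ((toTensor (ZMod p) X).toLinearMap.toAddMonoidHom).comp (redLie X p).toLinearMap.toAddMonoidHom := by
    refine addMonoidHom_ext_of_map_lie ?_ ?_ ?_
    · intro a b
      change redTensor X p (toTensor ℤ X ⁅a, b⁆) = ⁅redTensor X p (toTensor ℤ X a), redTensor X p (toTensor ℤ X b)⁆
      rw [LieHom.map_lie, LieRing.of_associative_ring_bracket, LieRing.of_associative_ring_bracket,
        map_sub, map_mul, map_mul]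
    · intro a b
      change toTensor (ZMod p) X (redLie X p ⁅a, b⁆) = ⁅toTensor (ZMod p) X (redLie X p a), toTensor (ZMod p) X (redLie X p b)⁆
      rw [LieHom.map_lie, LieHom.map_lie]
    · intro x
      change redTensor X p (toTensor ℤ X (FreeLieAlgebra.of ℤ x)) = toTensor (ZMod p) X (redLie X p (FreeLieAlgebra.of ℤ x))
      rw [toTensor_of, redLie_of, toTensor_of, redTensor_single, Int.cast_one]
  exact DFunLike.congr_fun key u

/-- The Lie ideal `p L_ℤ(X)` of multiples of `p`. [folklore] -/
def mulIdeal : LieIdeal ℤ (FreeLieAlgebra ℤ X) :=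
  { LinearMap.range ((p : ℤ) • (LinearMap.id : FreeLieAlgebra ℤ X →ₗ[ℤ] FreeLieAlgebra ℤ X)) with
    lie_mem := by
      rintro a _ ⟨b, rfl⟩
      refine ⟨⁅a, b⁆, ?_⟩
      simp only [LinearMap.smul_apply, LinearMap.id_coe, id_eq, lie_smul] }

/-- Membership in `p L_ℤ(X)`. [folklore] -/
theorem mem_mulIdeal_iff {u : FreeLieAlgebra ℤ X} : u ∈ mulIdeal X p ↔ ∃ v, (p : ℤ) • v = u := by
  change u ∈ LinearMap.range _ ↔ _
  simp only [LinearMap.mem_range, LinearMap.smul_apply, LinearMap.id_coe, id_eq]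

/-- `L_ℤ(X)/p`, an auxiliary `𝔽_p`-Lie algebra. [folklore] -/
def ModP : Type _ := FreeLieAlgebra ℤ X ⧸ mulIdeal X p

/-- Lie ring structure of `L_ℤ(X)/p`. [folklore] -/
instance ModP.instLieRing : LieRing (ModP X p) :=
  inferInstanceAs (LieRing (FreeLieAlgebra ℤ X ⧸ mulIdeal X p))

/-- `ℤ`-Lie algebra structure of `L_ℤ(X)/p`. [folklore] -/
instance ModP.instLieAlgebraInt : LieAlgebra ℤ (ModP X p) :=
  inferInstanceAs (LieAlgebra ℤ (FreeLieAlgebra ℤ X ⧸ mulIdeal X p))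

/-- The quotient map `L_ℤ(X) → L_ℤ(X)/p`. [folklore] -/
def ModP.mk : FreeLieAlgebra ℤ X →ₗ⁅ℤ⁆ ModP X p :=
  { (LieSubmodule.Quotient.mk' (mulIdeal X p)).toLinearMap with
    map_lie' := fun {_ _} => rfl }

/-- Kernel of the quotient map. [folklore] -/
theorem ModP.mk_eq_zero_iff {u : FreeLieAlgebra ℤ X} : ModP.mk X p u = 0 ↔ u ∈ mulIdeal X p :=
  show LieSubmodule.Quotient.mk (N := mulIdeal X p) u = 0 ↔ _ from
    LieSubmodule.Quotient.mk_eq_zero' (N := mulIdeal X p)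

/-- Every element of `L_ℤ(X)/p` is a class. [folklore] -/
theorem ModP.mk_surjective : Function.Surjective (ModP.mk X p) := fun a => by
  obtain ⟨u, hu⟩ := LieSubmodule.Quotient.surjective_mk' (mulIdeal X p) a
  exact ⟨u, hu⟩

/-- `L_ℤ(X)/p` is killed by `p`. [folklore] -/
theorem ModP.nsmul_eq_zero (a : ModP X p) : p • a = 0 := by
  obtain ⟨u, rfl⟩ := ModP.mk_surjective X p a
  rw [← map_nsmul, ModP.mk_eq_zero_iff, mem_mulIdeal_iff]
  exact ⟨u, by rw [← natCast_zsmul]⟩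

/-- The `𝔽_p`-module structure of `L_ℤ(X)/p`. [folklore] -/
instance ModP.instModule : Module (ZMod p) (ModP X p) := AddCommGroup.zmodModule (ModP.nsmul_eq_zero X p)

/-- The `𝔽_p`-Lie algebra structure of `L_ℤ(X)/p`. [folklore] -/
instance ModP.instLieAlgebra : LieAlgebra (ZMod p) (ModP X p) :=
  ⟨fun c a b => by
    rw [← ZMod.intCast_zmod_cast c, Int.cast_smul_eq_zsmul, Int.cast_smul_eq_zsmul, lie_zsmul]⟩

/-- The comparison map `L_{𝔽_p}(X) → L_ℤ(X)/p` (letters to classes of letters). [folklore] -/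
def ModP.ψ : FreeLieAlgebra (ZMod p) X →ₗ⁅ZMod p⁆ ModP X p :=
  FreeLieAlgebra.lift (ZMod p) fun x => ModP.mk X p (FreeLieAlgebra.of ℤ x)

/-- `ψ ∘ redLie` is the quotient map. [folklore] -/
theorem ModP.ψ_redLie (u : FreeLieAlgebra ℤ X) : ModP.ψ X p (redLie X p u) = ModP.mk X p u := by
  have key : ((ModP.ψ X p).toLinearMap.toAddMonoidHom).comp (redLie X p).toLinearMap.toAddMonoidHom =
      (ModP.mk X p).toLinearMap.toAddMonoidHom := by
    refine addMonoidHom_ext_of_map_lie ?_ ?_ ?_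
    · intro a b
      change ModP.ψ X p (redLie X p ⁅a, b⁆) = ⁅ModP.ψ X p (redLie X p a), ModP.ψ X p (redLie X p b)⁆
      rw [LieHom.map_lie, LieHom.map_lie]
    · intro a b
      exact (ModP.mk X p).map_lie a b
    · intro x
      change ModP.ψ X p (redLie X p (FreeLieAlgebra.of ℤ x)) = ModP.mk X p (FreeLieAlgebra.of ℤ x)
      rw [redLie_of]
      exact FreeLieAlgebra.lift_of_apply _ x
  exact DFunLike.congr_fun key u

/-- **`ker (L_ℤ(X) → L_{𝔽_p}(X)) = p L_ℤ(X)`**: an element killed by reduction mod `p` is a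
multiple of `p`. [folklore] -/
theorem exists_eq_smul_of_redLie_eq_zero {u : FreeLieAlgebra ℤ X} (hu : redLie X p u = 0) :
    ∃ v, (p : ℤ) • v = u := by
  rw [← mem_mulIdeal_iff, ← ModP.mk_eq_zero_iff, ← ModP.ψ_redLie, hu, map_zero]

end Reduction

/-! ## Over `ℤ`: Witt's theorem -/

section Int

variable (X : Type*)

/-- A finitely generated abelian group which is `p`-divisible for every prime `p` is trivial.
[folklore] -/
theorem eq_bot_of_forall_prime {V : Type*} [AddCommGroup V] (N : Submodule ℤ V) (hN : N.FG)
    (h : ∀ p : ℕ, p.Prime → ∀ u ∈ N, ∃ v ∈ N, (p : ℤ) • v = u) : N = ⊥ := by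
  -- Nakayama gives, for each prime `p`, an integer `r_p ≡ 1 (mod p)` killing `N`.
  have hr : ∀ p : ℕ, p.Prime → ∃ r : ℤ, (p : ℤ) ∣ r - 1 ∧ ∀ u ∈ N, r • u = 0 := by
    intro p hp
    have hle : N ≤ Ideal.span {(p : ℤ)} • N := by
      intro u hu
      obtain ⟨v, hv, rfl⟩ := h p hp u hu
      exact Submodule.smul_mem_smul (Ideal.mem_span_singleton_self _) hv
    obtain ⟨r, hr1, hr0⟩ := Submodule.exists_sub_one_mem_and_smul_eq_zero_of_fg_of_le_smul _ N hN hle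
    exact ⟨r, Ideal.mem_span_singleton.1 hr1, hr0⟩
  rw [eq_bot_iff]
  intro u hu
  rw [Submodule.mem_bot]
  by_contra hne
  obtain ⟨r₂, hr₂, hr₂N⟩ := hr 2 Nat.prime_two
  -- the additive order `o` of `u` divides the odd number `r₂`, so it is a positive odd number `> 1`
  have hdvd : ∀ r : ℤ, r • u = 0 → (addOrderOf u : ℤ) ∣ r := fun r hr =>
    (addOrderOf_dvd_iff_zsmul_eq_zero).2 hr
  have h2 := hdvd r₂ (hr₂N u hu)
  have hr₂0 : r₂ ≠ 0 := by
    rintro rfl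
    have h01 : (2 : ℤ) ∣ 0 - 1 := hr₂
    omega
  have ho0 : addOrderOf u ≠ 0 := by
    intro ho; rw [ho, Nat.cast_zero, zero_dvd_iff] at h2; exact hr₂0 h2
  have ho1 : addOrderOf u ≠ 1 := by rwa [Ne, AddMonoid.addOrderOf_eq_one_iff]
  obtain ⟨q, hq, hqo⟩ := Nat.exists_prime_and_dvd ho1
  obtain ⟨r, hr1, hrN⟩ := hr q hq
  have hq' : (q : ℤ) ∣ r := (Int.natCast_dvd_natCast.2 hqo).trans (hdvd r (hrN u hu))
  have : (q : ℤ) ∣ 1 := by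
    have := dvd_sub hq' hr1
    rwa [sub_sub_cancel] at this
  exact hq.one_lt.ne' (by exact_mod_cast Int.eq_one_of_dvd_one (Int.natCast_nonneg q) this)

variable [Finite X]

/-- **Witt's embedding theorem**: for a finite alphabet `X`, the canonical map from the free Lie
ring `L_ℤ(X)` to the free associative ring `ℤ[FreeMonoid X]` is injective (Witt 1937, Satz 3;
Bourbaki LIE II §3.1 Th. 1; Reutenauer Cor. 1.4). The classical proofs use Hall/Lyndon bases; here
it is derived from PBW over the prime fields. [folklore] -/
theorem toTensor_int_injective : Function.Injective (toTensor ℤ X) := by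
  -- Step 1: the homogeneous kernels vanish.
  have hdeg : ∀ n, ∀ u ∈ freeLieGrade ℤ X n, toTensor ℤ X u = 0 → u = 0 := by
    intro n
    let Kn : Submodule ℤ (FreeLieAlgebra ℤ X) :=
      LinearMap.ker (toTensor ℤ X).toLinearMap ⊓ freeLieGrade ℤ X n
    have hKfg : Kn.FG := by
      haveI : IsNoetherian ℤ ↥(freeLieGrade ℤ X n) :=
        isNoetherian_of_fg_of_noetherian _ (fg_freeLieGrade ℤ X n)
      have h1 : (Kn.comap (freeLieGrade ℤ X n).subtype).FG := IsNoetherian.noetherian _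
      have h2 := h1.map (freeLieGrade ℤ X n).subtype
      rwa [Submodule.map_comap_eq_self] at h2
      rw [Submodule.range_subtype]
      exact inf_le_right
    have hK : Kn = ⊥ := by
      refine eq_bot_of_forall_prime Kn hKfg fun p hp u hu => ?_
      haveI : Fact p.Prime := ⟨hp⟩
      obtain ⟨hu0, hun⟩ := hu
      rw [SetLike.mem_coe, LinearMap.mem_ker] at hu0
      change toTensor ℤ X u = 0 at hu0
      -- reduce mod `p`: `φ_p (red u) = red (φ u) = 0`, so `red u = 0`, so `u = p • u₁`
      have hred : redLie X p u = 0 := by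
        apply toTensor_injective_of_field (ZMod p) X
        rw [← redTensor_toTensor, hu0, map_zero, map_zero]
      obtain ⟨u₁, rfl⟩ := exists_eq_smul_of_redLie_eq_zero X p hred
      -- project back to degree `n`
      refine ⟨gradeProj ℤ X n u₁, ⟨?_, gradeProj_mem ℤ X n u₁⟩, ?_⟩
      · rw [SetLike.mem_coe, LinearMap.mem_ker]
        change toTensor ℤ X (gradeProj ℤ X n u₁) = 0
        have h1 : toTensor ℤ X u₁ = 0 := by
          have : (p : ℤ) • toTensor ℤ X u₁ = 0 := by rw [← map_zsmul, hu0]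
          exact (smul_eq_zero.1 this).resolve_left (by exact_mod_cast hp.ne_zero)
        rw [toTensor_gradeProj, h1, map_zero]
      · rw [← map_zsmul, gradeProj_apply_of_mem_self ℤ X hun]
    intro u hun hu0
    have : u ∈ Kn := ⟨by rw [SetLike.mem_coe, LinearMap.mem_ker]; exact hu0, hun⟩
    rw [hK] at this
    exact (Submodule.mem_bot ℤ).1 this
  -- Step 2: decompose an arbitrary kernel element into homogeneous components.
  intro u v huv
  rw [← sub_eq_zero] at huv ⊢
  rw [← map_sub] at huv
  refine eq_zero_of_forall_gradeProj_eq_zero ℤ X fun n => hdeg n _ (gradeProj_mem ℤ X n _) ?_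
  rw [toTensor_gradeProj, huv, map_zero]

/-- **The free Lie ring on a finite set is torsion-free**. [folklore] -/
theorem noZeroSMulDivisors_int_freeLieAlgebra : NoZeroSMulDivisors ℤ (FreeLieAlgebra ℤ X) := by
  refine ⟨fun {c u} h => ?_⟩
  by_cases hc : c = 0
  · exact Or.inl hc
  · right
    apply toTensor_int_injective X
    have : c • toTensor ℤ X u = 0 := by rw [← map_zsmul, h, map_zero]
    rw [map_zero]
    exact (smul_eq_zero.1 this).resolve_left hc

end Int

end Literature.Algebra.Lie
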